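import Summits.Ventures.GridStability.Bench.SMIBDeg2AK13postD10Data
import Mathlib.Tactic.LinearCombination
import Mathlib.Tactic.Positivity

/-!
# SMIBDeg2AK13postD10 — THEOREMS part (kernel checks + certified inequalities)

Data (model block, `Poly`/`GramSOS`/`CertG` literals) live in `SMIBDeg2AK13postD10Data.lean` (statement-only sibling);
this file holds one `SOS.Poly.checkG … = true := by decide +kernel` theorem per identity and the real-variable
inequalities derived by `nonneg_of_checkG`. See the Data file's docstring for the THREE-COLUMN text, model, provenance.
-/

namespace Summit.Ventures.GridStability.Bench.SMIB

open Literature.Computation.Certificates Literature.Computation.Certificates.SOS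
open Literature.Computation.Certificates.SOS.Poly

/-- KERNEL CHECK `deg2_A_K13postD10_V_pos`: every Gram block passes `PSD.IsGramCertDD` and the residual `p − (σ₀ + Σ gᵢσᵢ + Σ hⱼtⱼ)` is the zero polynomial (`SOS.Poly.checkG`, ONE reduction). [folklore] -/
theorem deg2_A_K13postD10_V_pos_check : checkG deg2_A_K13postD10_V_pos_p deg2_A_K13postD10_V_pos_gs deg2_A_K13postD10_V_pos_hs deg2_A_K13postD10_V_pos_cert = true := by
  decide +kernel

/-- KERNEL CHECK `deg2_A_K13postD10_Vdot_neg`: every Gram block passes `PSD.IsGramCertDD` and the residual `p − (σ₀ + Σ gᵢσᵢ + Σ hⱼtⱼ)` is the zero polynomial (`SOS.Poly.checkG`, ONE reduction). [folklore] -/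
theorem deg2_A_K13postD10_Vdot_neg_check : checkG deg2_A_K13postD10_Vdot_neg_p deg2_A_K13postD10_Vdot_neg_gs deg2_A_K13postD10_Vdot_neg_hs deg2_A_K13postD10_Vdot_neg_cert = true := by
  decide +kernel

/-- KERNEL CHECK `deg2_A_K13postD10_level_in_ball`: every Gram block passes `PSD.IsGramCertDD` and the residual `p − (σ₀ + Σ gᵢσᵢ + Σ hⱼtⱼ)` is the zero polynomial (`SOS.Poly.checkG`, ONE reduction). [folklore] -/
theorem deg2_A_K13postD10_level_in_ball_check : checkG deg2_A_K13postD10_level_in_ball_p deg2_A_K13postD10_level_in_ball_gs deg2_A_K13postD10_level_in_ball_hs deg2_A_K13postD10_level_in_ball_cert = true := by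
  decide +kernel

/-- KERNEL CHECK `deg2_A_K13postD10_arc_excl`: every Gram block passes `PSD.IsGramCertDD` and the residual `p − (σ₀ + Σ gᵢσᵢ + Σ hⱼtⱼ)` is the zero polynomial (`SOS.Poly.checkG`, ONE reduction). [folklore] -/
theorem deg2_A_K13postD10_arc_excl_check : checkG deg2_A_K13postD10_arc_excl_p deg2_A_K13postD10_arc_excl_gs deg2_A_K13postD10_arc_excl_hs deg2_A_K13postD10_arc_excl_cert = true := by
  decide +kernel

/-- **`deg2_A_K13postD10_V_pos`** (CERTIFIED, model `SMIB instance SMIB-K13post-D10 (model-1 I2 file, f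
verbatim)`; ALGEBRAIC inequality, ROA inclusion pending Lyapunov/ lemma): V - eps_pos*phi >= 0 on {h
= 0} — for every real point satisfying the listed hypotheses (hh). [folklore] -/
theorem deg2_A_K13postD10_V_pos (sigma kappa omega : ℝ) (hh : deg2_A_K13postD10_h sigma kappa omega = 0) :
    (1 / 100 : ℝ) * (((1 : ℝ) / 36) * omega ^ 2 + (1 : ℝ) * kappa ^ 2 + (1 : ℝ) * sigma ^ 2) ≤ deg2_A_K13postD10_V sigma kappa omega := by
  simp only [deg2_A_K13postD10_V]
  simp only [deg2_A_K13postD10_h] at hh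
  have h := nonneg_of_checkG deg2_A_K13postD10_V_pos_check (vars [sigma, kappa, omega])
    (by simp [deg2_A_K13postD10_V_pos_gs])
    (by
      intro q hq
      simp only [deg2_A_K13postD10_V_pos_hs, List.mem_cons, List.not_mem_nil, or_false] at hq
      rcases hq with rfl
      · simp only [eval_cons, eval_nil, Monomial.eval_eq, Monomial.evalFrom_cons, Monomial.evalFrom_nil,
        vars_cons_zero, vars_cons_succ]
        push_cast
        linear_combination hh)
  simp only [deg2_A_K13postD10_V_pos_p, eval_cons, eval_nil, Monomial.eval_eq, Monomial.evalFrom_cons, Monomial.evalFrom_nil,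
        vars_cons_zero, vars_cons_succ] at h
  push_cast at h
  linear_combination h

/-- **`deg2_A_K13postD10_Vdot_neg`** (CERTIFIED, model `SMIB instance SMIB-K13post-D10 (model-1 I2 file,
f verbatim)`; ALGEBRAIC inequality, ROA inclusion pending Lyapunov/ lemma): -Vdot - eps_dot*phi >= 0
on {level - V >= 0} cap {h = 0} (Vdot = grad V . f) — for every real point satisfying the listed
hypotheses (hV, hh). [folklore] -/
theorem deg2_A_K13postD10_Vdot_neg (sigma kappa omega : ℝ) (hV : deg2_A_K13postD10_V sigma kappa omega ≤ (19 / 8 : ℝ)) (hh : deg2_A_K13postD10_h sigma kappa omega = 0) :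
    deg2_A_K13postD10_Vdot sigma kappa omega ≤ -(1 / 2000 : ℝ) * (((1 : ℝ) / 36) * omega ^ 2 + (1 : ℝ) * kappa ^ 2 + (1 : ℝ) * sigma ^ 2) := by
  simp only [deg2_A_K13postD10_Vdot, deg2_A_K13postD10_f_sigma, deg2_A_K13postD10_f_kappa, deg2_A_K13postD10_f_omega]
  simp only [deg2_A_K13postD10_V] at hV
  simp only [deg2_A_K13postD10_h] at hh
  have h := nonneg_of_checkG deg2_A_K13postD10_Vdot_neg_check (vars [sigma, kappa, omega])
    (by
      intro g hg
      simp only [deg2_A_K13postD10_Vdot_neg_gs, List.mem_cons, List.not_mem_nil, or_false] at hg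
      rcases hg with rfl
      · simp only [eval_cons, eval_nil, Monomial.eval_eq, Monomial.evalFrom_cons, Monomial.evalFrom_nil,
        vars_cons_zero, vars_cons_succ]
        push_cast
        linear_combination hV)
    (by
      intro q hq
      simp only [deg2_A_K13postD10_Vdot_neg_hs, List.mem_cons, List.not_mem_nil, or_false] at hq
      rcases hq with rfl
      · simp only [eval_cons, eval_nil, Monomial.eval_eq, Monomial.evalFrom_cons, Monomial.evalFrom_nil,
        vars_cons_zero, vars_cons_succ]
        push_cast
        linear_combination hh)
  simp only [deg2_A_K13postD10_Vdot_neg_p, eval_cons, eval_nil, Monomial.eval_eq, Monomial.evalFrom_cons, Monomial.evalFrom_nil,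
        vars_cons_zero, vars_cons_succ] at h
  push_cast at h
  linear_combination h

/-- **`deg2_A_K13postD10_level_in_ball`** (CERTIFIED, model `SMIB instance SMIB-K13post-D10 (model-1 I2
file, f verbatim)`; ALGEBRAIC inequality, ROA inclusion pending Lyapunov/ lemma): r2 - phi >= 0 on
{level - V >= 0} cap {h = 0} (typed inclusion {V <= level} cap {h=0} in D = {phi <= r2}, PARTITION
A2) — for every real point satisfying the listed hypotheses (hV, hh). [folklore] -/
theorem deg2_A_K13postD10_level_in_ball (sigma kappa omega : ℝ) (hV : deg2_A_K13postD10_V sigma kappa omega ≤ (19 / 8 : ℝ)) (hh : deg2_A_K13postD10_h sigma kappa omega = 0) :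
    0 ≤ ((-1 : ℝ) / 36) * omega ^ 2 + (-1 : ℝ) * kappa ^ 2 + (-1 : ℝ) * sigma ^ 2 + (1 : ℝ) := by
  simp only [deg2_A_K13postD10_V] at hV
  simp only [deg2_A_K13postD10_h] at hh
  have h := nonneg_of_checkG deg2_A_K13postD10_level_in_ball_check (vars [sigma, kappa, omega])
    (by
      intro g hg
      simp only [deg2_A_K13postD10_level_in_ball_gs, List.mem_cons, List.not_mem_nil, or_false] at hg
      rcases hg with rfl
      · simp only [eval_cons, eval_nil, Monomial.eval_eq, Monomial.evalFrom_cons, Monomial.evalFrom_nil,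
        vars_cons_zero, vars_cons_succ]
        push_cast
        linear_combination hV)
    (by
      intro q hq
      simp only [deg2_A_K13postD10_level_in_ball_hs, List.mem_cons, List.not_mem_nil, or_false] at hq
      rcases hq with rfl
      · simp only [eval_cons, eval_nil, Monomial.eval_eq, Monomial.evalFrom_cons, Monomial.evalFrom_nil,
        vars_cons_zero, vars_cons_succ]
        push_cast
        linear_combination hh)
  simp only [deg2_A_K13postD10_level_in_ball_p, eval_cons, eval_nil, Monomial.eval_eq, Monomial.evalFrom_cons, Monomial.evalFrom_nil,
        vars_cons_zero, vars_cons_succ] at h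
  push_cast at h
  linear_combination h

/-- **`deg2_A_K13postD10_arc_excl`** (CERTIFIED, model `SMIB instance SMIB-K13post-D10 (model-1 I2 file,
f verbatim)`; ALGEBRAIC inequality, ROA inclusion pending Lyapunov/ lemma): kappa_max - kappa >= 0
on {level - V >= 0} cap {h = 0} (arc exclusion kappa = 1 - cos(u) <= kappa_max < 2: director RULING
3 (4) / MODEL-VALIDITY MV-1(e)) — for every real point satisfying the listed hypotheses (hV, hh). [folklore] -/
theorem deg2_A_K13postD10_arc_excl (sigma kappa omega : ℝ) (hV : deg2_A_K13postD10_V sigma kappa omega ≤ (19 / 8 : ℝ)) (hh : deg2_A_K13postD10_h sigma kappa omega = 0) :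
    0 ≤ (-1 : ℝ) * kappa + (1 : ℝ) := by
  simp only [deg2_A_K13postD10_V] at hV
  simp only [deg2_A_K13postD10_h] at hh
  have h := nonneg_of_checkG deg2_A_K13postD10_arc_excl_check (vars [sigma, kappa, omega])
    (by
      intro g hg
      simp only [deg2_A_K13postD10_arc_excl_gs, List.mem_cons, List.not_mem_nil, or_false] at hg
      rcases hg with rfl
      · simp only [eval_cons, eval_nil, Monomial.eval_eq, Monomial.evalFrom_cons, Monomial.evalFrom_nil,
        vars_cons_zero, vars_cons_succ]
        push_cast
        linear_combination hV)
    (by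
      intro q hq
      simp only [deg2_A_K13postD10_arc_excl_hs, List.mem_cons, List.not_mem_nil, or_false] at hq
      rcases hq with rfl
      · simp only [eval_cons, eval_nil, Monomial.eval_eq, Monomial.evalFrom_cons, Monomial.evalFrom_nil,
        vars_cons_zero, vars_cons_succ]
        push_cast
        linear_combination hh)
  simp only [deg2_A_K13postD10_arc_excl_p, eval_cons, eval_nil, Monomial.eval_eq, Monomial.evalFrom_cons, Monomial.evalFrom_nil,
        vars_cons_zero, vars_cons_succ] at h
  push_cast at h
  linear_combination h

/-- **Certificate `SMIB-deg2-A-K13postD10`** (CERTIFIED, model `SMIB instance SMIB-K13post-D10 (model-1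
I2 file, f verbatim)`; README §3 T3 shape): under the listed hypotheses (hh, hV) all 4 certified
inequalities hold. «algebraic inequalities certified; ROA inclusion pending Lyapunov/ lemma»
(PARTITION A2). [folklore] -/
theorem deg2_A_K13postD10_certificate (sigma kappa omega : ℝ) (hh : deg2_A_K13postD10_h sigma kappa omega = 0) (hV : deg2_A_K13postD10_V sigma kappa omega ≤ (19 / 8 : ℝ)) :
    (1 / 100 : ℝ) * (((1 : ℝ) / 36) * omega ^ 2 + (1 : ℝ) * kappa ^ 2 + (1 : ℝ) * sigma ^ 2) ≤ deg2_A_K13postD10_V sigma kappa omega ∧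
    deg2_A_K13postD10_Vdot sigma kappa omega ≤ -(1 / 2000 : ℝ) * (((1 : ℝ) / 36) * omega ^ 2 + (1 : ℝ) * kappa ^ 2 + (1 : ℝ) * sigma ^ 2) ∧
    0 ≤ ((-1 : ℝ) / 36) * omega ^ 2 + (-1 : ℝ) * kappa ^ 2 + (-1 : ℝ) * sigma ^ 2 + (1 : ℝ) ∧
    0 ≤ (-1 : ℝ) * kappa + (1 : ℝ) :=
  ⟨deg2_A_K13postD10_V_pos sigma kappa omega hh, deg2_A_K13postD10_Vdot_neg sigma kappa omega hV hh, deg2_A_K13postD10_level_in_ball sigma kappa omega hV hh, deg2_A_K13postD10_arc_excl sigma kappa omega hV hh⟩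

end Summit.Ventures.GridStability.Bench.SMIB
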